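import Summits.AtomisticToContinuum.FouriersLaw.Theorems.BondHeatUncertaintySubdiffusiveBondHeatGibbsMomentumFourthMoment
import Literature.MathematicalPhysics.KineticTheory.LangevinChainHormander

/-!
# `N`-uniform statics for the bond-heat window laws, part A: virial algebra

Support file for item `stmt-AtomisticToContinuum-9123` (`BondHeatUncertainty.LightConeBondHeat`; equally for the crux
`SubdiffusiveBondHeat`, stmt-9120).  Both window laws bound the equilibrium bond-heat variance
`V_N(b,t) = 2∫₀ᵗ(t−s)C_N(b,s)ds` of the pinned anharmonic chain at a bond `b` CHOSEN BY THE PROVER by `A√t` with `A`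
INDEPENDENT of `N`; since `|C_N(b,s)| ≤ ⟨j_b²⟩_T` (file `…LightConeBondHeatBondCorrelation`), the first input of any
such proof is an `N`-uniform bound on the static current fluctuation `⟨j_b²⟩_T = ∫ j_b² dμ_T^N` at some bulk bond.
Parts A–D prove it (`pinnedChain_exists_bond_sq_bondCurrent_le`, part D): for every `N ≥ 2` some bond has
`⟨j_b²⟩_T ≤ 4T² + 768β²T³/(lam ω₂)`, by two integrations by parts against `e^{-H/T}` (the position virial
identities `∫ q_i^n ∂_{q_i}H e^{-H/T} = nT∫ q_i^{n-1} e^{-H/T}`, `n = 1, 3`, and the Gaussian momentum identity),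
pointwise sign identities for the FPU-β/φ⁴ potentials, and averaging over the bonds.

This part is pure algebra: the weighted virial sum `∑_i w_i ∂Φ/∂q_i = ∑_i w_i U'(q_i) + ∑_{l=k+1} V'(q_l − q_k)(w_l − w_k)`
(`sum_mul_dPotential`), bookkeeping of bond sums, the closed form of the bond current on a genuine bond, and the
pointwise inequalities `V'(b − a)(b³ − a³) ≥ 0`, `(b − a)⁶ ≤ 32(a⁶ + b⁶)`.
-/

noncomputable section

open MeasureTheory

namespace Summit.AtomisticToContinuum.FouriersLaw.Theorems.LightConeBondHeat

open Literature.MathematicalPhysics.KineticTheory.HeatConduction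
open Summit.AtomisticToContinuum.FouriersLaw.Theorems.SubdiffusiveBondHeat

variable {N : ℕ}

/-! ### Algebra: weighted virial sums -/

/-- **Weighted virial sum.** For weights `w` and positions `q`:
`∑_i w_i ∂Φ/∂q_i = ∑_i w_i U'(q_i) + ∑_{l = k+1} V'(q_l - q_k) (w_l - w_k)` — the bond forces act on the two ends
of each bond with opposite signs (action–reaction), so against weights they pair to differences. [folklore] -/
theorem sum_mul_dPotential (P : OscillatorChain) (N : ℕ) (w q : Fin N → ℝ) :
    ∑ i, w i * P.dPotential N i q =
      (∑ i, w i * deriv P.U (q i)) +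
        ∑ k : Fin N, ∑ l : Fin N,
          if l.val = k.val + 1 then deriv P.V (q l - q k) * (w l - w k) else 0 := by
  unfold OscillatorChain.dPotential
  simp only [mul_add, Finset.sum_add_distrib]
  congr 1
  have hin : ∀ i : Fin N, w i * (∑ k : Fin N, ∑ l : Fin N, (if l.val = k.val + 1 then
      deriv P.V (q l - q k) * ((if l = i then 1 else 0) - (if k = i then 1 else 0)) else 0)) =
      ∑ k : Fin N, ∑ l : Fin N, (if l.val = k.val + 1 then
        deriv P.V (q l - q k) * (w i * ((if l = i then 1 else 0) - (if k = i then 1 else 0))) else 0) := by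
    intro i
    rw [Finset.mul_sum]
    refine Finset.sum_congr rfl fun k _ => ?_
    rw [Finset.mul_sum]
    refine Finset.sum_congr rfl fun l _ => ?_
    split_ifs <;> ring
  simp_rw [hin]
  rw [Finset.sum_comm]
  refine Finset.sum_congr rfl fun k _ => ?_
  rw [Finset.sum_comm]
  refine Finset.sum_congr rfl fun l _ => ?_
  by_cases h : l.val = k.val + 1
  · simp only [h, if_true]
    rw [← Finset.mul_sum]
    congr 1
    simp only [mul_sub, Finset.sum_sub_distrib, mul_ite, mul_one, mul_zero]
    rw [Finset.sum_ite_eq Finset.univ l, Finset.sum_ite_eq Finset.univ k]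
    simp
  · simp [h]

/-- A double sum over the bonds `l = k + 1` of a function of the bond is the single sum over `k` with `k + 1 < N`
(the partner `l` is determined). [folklore] -/
theorem sum_sum_bond_eq (N : ℕ) (F : Fin N → Fin N → ℝ) :
    (∑ k : Fin N, ∑ l : Fin N, if l.val = k.val + 1 then F k l else 0) =
      ∑ k : Fin N, if h : k.val + 1 < N then F k ⟨k.val + 1, h⟩ else 0 := by
  refine Finset.sum_congr rfl fun k _ => ?_
  by_cases h : k.val + 1 < N
  · rw [dif_pos h, Finset.sum_eq_single ⟨k.val + 1, h⟩]
    · simp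
    · intro l _ hl
      rw [if_neg]
      intro hv
      exact hl (Fin.ext hv)
    · intro h'
      exact absurd (Finset.mem_univ _) h'
  · rw [dif_neg h]
    refine Finset.sum_eq_zero fun l _ => ?_
    rw [if_neg]
    intro hv
    exact h (hv ▸ l.isLt)

/-- Closed form of the bond current on a genuine bond `(b, b+1)`. [folklore] -/
theorem bondCurrent_eq_of_lt (P : OscillatorChain) {i : Fin N} (h : i.val + 1 < N) (x : PhaseSpace N) :
    P.bondCurrent N i x = -((x.2 i + x.2 ⟨i.val + 1, h⟩) / 2 * deriv P.V (x.1 ⟨i.val + 1, h⟩ - x.1 i)) := by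
  unfold OscillatorChain.bondCurrent
  rw [Finset.sum_eq_single ⟨i.val + 1, h⟩]
  · simp
  · intro j _ hj
    rw [if_neg]
    intro hv
    exact hj (Fin.ext hv)
  · intro h'
    exact absurd (Finset.mem_univ _) h'

/-- Each site belongs to at most two bonds: for `f ≥ 0`, `∑_{l = k+1} (f l + f k) ≤ 2 ∑_i f i`. [folklore] -/
theorem sum_bond_ends_le (N : ℕ) {f : Fin N → ℝ} (hf : ∀ i, 0 ≤ f i) :
    (∑ k : Fin N, ∑ l : Fin N, if l.val = k.val + 1 then f l + f k else 0) ≤ 2 * ∑ i, f i := by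
  have h1 : (∑ k : Fin N, ∑ l : Fin N, if l.val = k.val + 1 then f l else 0) ≤ ∑ i, f i := by
    rw [Finset.sum_comm]
    refine Finset.sum_le_sum fun l _ => ?_
    by_cases hl : 0 < l.val
    · rw [Finset.sum_eq_single ⟨l.val - 1, by omega⟩]
      · split_ifs <;> simp [hf]
      · intro k _ hk
        rw [if_neg]
        intro hv
        apply hk
        ext
        simp only
        omega
      · intro h'
        exact absurd (Finset.mem_univ _) h'
    · rw [Finset.sum_eq_zero]
      · exact hf l
      · intro k _
        rw [if_neg]
        omega
  have h2 : (∑ k : Fin N, ∑ l : Fin N, if l.val = k.val + 1 then f k else 0) ≤ ∑ i, f i := by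
    refine Finset.sum_le_sum fun k _ => ?_
    by_cases hk : k.val + 1 < N
    · rw [Finset.sum_eq_single ⟨k.val + 1, hk⟩]
      · simp
      · intro l _ hl
        rw [if_neg]
        intro hv
        exact hl (Fin.ext hv)
      · intro h'
        exact absurd (Finset.mem_univ _) h'
    · rw [Finset.sum_eq_zero]
      · exact hf k
      · intro l _
        rw [if_neg]
        intro hv
        exact hk (hv ▸ l.isLt)
  have hsplit : (∑ k : Fin N, ∑ l : Fin N, if l.val = k.val + 1 then f l + f k else 0) =
      (∑ k : Fin N, ∑ l : Fin N, if l.val = k.val + 1 then f l else 0) +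
        ∑ k : Fin N, ∑ l : Fin N, if l.val = k.val + 1 then f k else 0 := by
    rw [← Finset.sum_add_distrib]
    refine Finset.sum_congr rfl fun k _ => ?_
    rw [← Finset.sum_add_distrib]
    refine Finset.sum_congr rfl fun l _ => ?_
    split_ifs <;> simp
  rw [hsplit]
  linarith

/-! ### Pointwise inequalities for the pinned anharmonic chain -/

section Pointwise

variable {ω₂ lam β : ℝ}

/-- `V'(b - a)(b³ - a³) ≥ 0`: `b³ - a³ = (b - a)(a² + ab + b²)` and `V'(r) r = r²(1 + βr²) ≥ 0`. [folklore] -/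
theorem pinnedChain_deriv_V_mul_cube_sub_nonneg (hβ : 0 ≤ β) (γ a b : ℝ) :
    0 ≤ deriv (pinnedChain ω₂ lam β γ).V (b - a) * (b ^ 3 - a ^ 3) := by
  rw [pinnedChain_deriv_V]
  have h1 : 0 ≤ a ^ 2 + a * b + b ^ 2 := by nlinarith [sq_nonneg (a + b), sq_nonneg a, sq_nonneg b]
  have h2 : 0 ≤ (b - a) ^ 2 * (1 + β * (b - a) ^ 2) := by
    have : 0 ≤ 1 + β * (b - a) ^ 2 := by nlinarith [mul_nonneg hβ (sq_nonneg (b - a))]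
    exact mul_nonneg (sq_nonneg _) this
  have e : (b - a + β * (b - a) ^ 3) * (b ^ 3 - a ^ 3) =
      ((b - a) ^ 2 * (1 + β * (b - a) ^ 2)) * (a ^ 2 + a * b + b ^ 2) := by ring
  rw [e]
  exact mul_nonneg h2 h1

/-- `(b - a)⁶ ≤ 32 (a⁶ + b⁶)`. [folklore] -/
theorem sub_pow_six_le (a b : ℝ) : (b - a) ^ 6 ≤ 32 * (a ^ 6 + b ^ 6) := by
  nlinarith [sq_nonneg (a + b), sq_nonneg (a - b), sq_nonneg (a ^ 2 - b ^ 2), sq_nonneg (a ^ 3 + b ^ 3),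
    sq_nonneg (a ^ 3 - b ^ 3), sq_nonneg (a * b), sq_nonneg (a ^ 2 + b ^ 2), sq_nonneg (a*b*(a+b)),
    sq_nonneg (a*b*(a-b)), mul_nonneg (sq_nonneg (a+b)) (sq_nonneg (a*b))]

end Pointwise


/-! ### Integrals of bond sums -/

/-- Integrals commute with the finite bond sums `∑_{l = k+1}` (weight `ρ`). [folklore] -/
theorem integral_sum_sum_bond_mul (N : ℕ) (F : Fin N → Fin N → PhaseSpace N → ℝ) (ρ : PhaseSpace N → ℝ)
    (hF : ∀ k l : Fin N, l.val = k.val + 1 → Integrable fun x => F k l x * ρ x) :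
    ∫ x, (∑ k : Fin N, ∑ l : Fin N, if l.val = k.val + 1 then F k l x else 0) * ρ x =
      ∑ k : Fin N, ∑ l : Fin N, if l.val = k.val + 1 then ∫ x, F k l x * ρ x else 0 := by
  have hterm : ∀ k l : Fin N, Integrable fun x => (if l.val = k.val + 1 then F k l x else 0) * ρ x := by
    intro k l
    by_cases h : l.val = k.val + 1
    · simp only [h, if_true]; exact hF k l h
    · simp only [h, if_false, zero_mul]; exact integrable_zero _ _ _
  simp_rw [Finset.sum_mul]
  rw [integral_finsetSum _ fun k _ => integrable_finsetSum _ fun l _ => hterm k l]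
  refine Finset.sum_congr rfl fun k _ => ?_
  rw [integral_finsetSum _ fun l _ => hterm k l]
  refine Finset.sum_congr rfl fun l _ => ?_
  by_cases h : l.val = k.val + 1
  · simp only [h, if_true]
  · simp only [h, if_false, zero_mul, integral_zero]

/-- Integrals commute with finite site sums (weight `ρ`). [folklore] -/
theorem integral_sum_mul (N : ℕ) (f : Fin N → PhaseSpace N → ℝ) (ρ : PhaseSpace N → ℝ)
    (hf : ∀ i, Integrable fun x => f i x * ρ x) :
    ∫ x, (∑ i, f i x) * ρ x = ∑ i, ∫ x, f i x * ρ x := by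
  simp_rw [Finset.sum_mul]
  exact integral_finsetSum _ fun i _ => hf i

end Summit.AtomisticToContinuum.FouriersLaw.Theorems.LightConeBondHeat

end
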